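import Summits.BirchSwinnertonDyer.Rank1Residual.X6.RankZeroCertificateEnclosure
import Summits.BirchSwinnertonDyer.Rank1Residual.X6.RankZeroCertificateErratumOddNamed
import Summits.BirchSwinnertonDyer.BirchSwinnertonDyer.Theorems.PrintX6EisensteinHalfFiveLeErrOdd
import HarnessLib

/-!
# Class X6 ∧ analytic rank `0` — `BSD(E,p)` for every ODD-ERRATUM certificate record BY NAME over the route's pack and the
# REPAIRED Err pack `PublishedAcInputsX6ErrOdd` (PLAN v4.8 (α), class key `eisensteinHalfFiveLeErrOdd_of_facts`): 103 records

Cell `bsd-print-x6` (D-0131 (2) print tier, key `x6`; HOME `run/shared/lean/pub/bsd-print-x6/`), typer seat ty3 (gen 7).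
Twin of `RankZeroCertificateClaimResidual.lean` §1 ERR road (p556955: `Record.bsdp_of_errAt` over `PublishedInputsX6 ∧
PublishedAcInputsX6Err`, 107 records at `p ≥ 5`, pack tier HELD → descriptive after R-5.1 except the rider
`Cas18-Thm32-dK-odd@BDP13`) for the REPAIRED key of PLAN v4.8: prover p2's (α3) `AnticyclotomicRankZero.eisensteinHalfFiveLeErrOdd_of_facts
: PublishedAcInputsX6ErrOdd → ∀ W p, ¬CM → 5 ≤ p → ClassX6 W p → r_an = 0 → HasOddErratumPrime W p → (E₅ body)` (p578156), ty2's
(α1)/(α2) `castellaWan2024_thm53_castella2018_thm32_constantCoeff_oddDisc` / `HasOddErratumPrime` / `PublishedAcInputsX6ErrOdd`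
(p576731 / p577618), and ty3's (α4) certificate `Record.errOddAt` ↦ `HasOddErratumPrime` (p576964 / p578603). PARTITION (D-0054):
leaf X6 ∧ r = 0 (K3 row A6) — types-the-object-of; closes NONE.

HONEST FRAMING: BSD is not proved here for any class or curve outright. Every `BSD(E,p)` below is per pair and CONDITIONAL, by
name, on (a) the route's input conjunction `PublishedInputsX6` (stmt-BirchSwinnertonDyer-20302) and (b) ty2's repaired pack
`Supersingular.PublishedAcInputsX6ErrOdd` (ten NAMED published facts: the Err pack with conjunct (10) restated over `K` of ODD
discriminant = Bertolini–Darmon–Prasanna 2013 Assumption 5.12 (3), the standing hypothesis under Castella 2018 Thm. 3.2) — its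
tier is the cell referee's word (α5; the director's W-53 carries the class line only after it) — and on (c) the record's CLAIM
(`r_an = 0`) or an explicit `r_an = 0` / enclosure line. `ClassX6`, `HasOddErratumPrime`, `Fact p.Prime`, `IsElliptic`,
`IsGloballyMinimal` are KERNEL theorems from the recheck. The unrefereed preprint BSTW arXiv:2409.01350 is NOT used.

WHAT THE DISPLAY SAYS:
* §0 pair level: `PublishedInputsX6 → PublishedAcInputsX6ErrOdd → 5 ≤ p → ClassX6 → r_an = 0 → HasOddErratumPrime → BSD(E,p)` —
  p2's Err socket composition verbatim with the repaired key as the lower half (upper half = the route's PROVED `UpperHalfX6`,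
  value-cell split `missingPPartAt_of_upper_of_nonUnit`, GZK = the ninth input).
* §1 per record `Record.bsdp_of_errOddAt` (claim) / `Record.bsdp_of_errOddAt_of_LOneBall` (claim-free, the record's level-one
  enclosure line, targets p560348); §2 census `bsdp_of_mem_errOddAt` — **the 103 odd-erratum census cells at `p ≥ 5`: `BSD(E,p)`
  by name over `PublishedInputsX6 ∧ PublishedAcInputsX6ErrOdd`, NO open crux, NO parity rider** (`errOdd_counts_five_le`);
  together with p577647's pair road these are the two refined roads whose union covers 111 of the 113 records (p577965
  `errOdd_or_inertPairCoprime_counts_five_le`); `bsdp_of_mem_errOddAt_of_LOneBall` claim-free.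
* §3 `hWeq` adapters `bsdp_of_exists_errOddAt` (`hPub`, `hAcO`, `h0`) / `_of_LOneBall` (the cell files' verbatim `hball0`), and BY
  NAME `bsdp_cell_<label>_at5_of_publishedInputsX6_of_publishedAcInputsX6ErrOdd` for the T3 witness cell `22678e1` and the EIGHT
  records that ONLY the odd-erratum key reaches among the two refined keys (p574374 `noInertPairCoprime_five_le_labels`, all Err
  with a single usable prime): `45298c1, 75966b1, 78483c1, 120974c1, 157263e1, 266113a1, 280343c1, 495403b1 @ 5`.

Two engines behind the certificates: HOME/ty3/erratum/X6R0-ERRATUM-v2.tsv (pure Python Tate `−c₆` criterion = PARI `a_q`) and the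
kernel. beyond-print theorem: NO (bookkeeping over landed theorems). References: Kobayashi 2003 Thm. 1.2 / 4.1 [Kobayashi2003];
B. D. Kim 2013 Cor. 3.15 [BDKim2013]; Castella–Wan 2024 Thm. 5.3 [CastellaWan2023]; Castella 2018 Thm. 2.3 / 3.2 [Castella2018];
Bertolini–Darmon–Prasanna 2013 Assumption 5.12, Thm. 5.13 [BertoliniDarmonPrasanna2013]; Friedberg–Hoffstein 1995 Thm. B
[FriedbergHoffstein1995]; Miller 2011 Def. 1.1 [Miller2011LMS]; Silverman *AEC* VII.5 Prop. 5.1 [SilvermanAEC2009];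
[BirchSwinnertonDyer1965]; [MazurTateTeitelbaum1986Invent] §I.8; Cremona's tables [Cremona2006]; HOME/PLAN.md v4.8, HOME/REFEREE.md R-5.1.
-/

set_option autoImplicit false

open scoped MatrixGroups ModularForm
open CongruenceSubgroup WeierstrassCurve Literature.NumberTheory.EllipticCurves Literature.NumberTheory.EllipticCurves.ModularForms
  Literature.NumberTheory.EllipticCurves.Rank1Residual Literature.NumberTheory.EllipticCurves.Rank1Residual.Typed
open Summit.BirchSwinnertonDyer.BirchSwinnertonDyer.Theses.PrintX6 (PublishedInputsX6)
open Summit.BirchSwinnertonDyer.Rank1Residual.Supersingular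
  (HasOddErratumPrime PublishedAcInputsX6ErrOdd missingPPartAt_of_upper_of_nonUnit analyticRank_eq_zero_of_LOneBall)

namespace Summit.BirchSwinnertonDyer.Rank1Residual.X6.PrintCert

/-! ### §0 Pair level: the socket over the route's pack and the repaired Err pack -/

/-- **`BSD(E,p)` on the odd-erratum sub-locus of the leaf over `PublishedInputsX6 ∧ PublishedAcInputsX6ErrOdd`, by name**: upper
half by the route's PROVED `UpperHalfX6` (`upperHalfX6_proof`), lower half on the non-unit value by p2's repaired class key
`AnticyclotomicRankZero.eisensteinHalfFiveLeErrOdd_of_facts` (`¬ CM` by `ClassX6.not_hasCM`), value-cell split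
`missingPPartAt_of_upper_of_nonUnit`, then `bsdp_of_missingPPartAt` with GZK (ninth input) — p2's
`X6.bsdp_of_publishedInputsX6_of_publishedAcInputsX6Err_of_hasErratumPrime` with Err ↦ ErrOdd. CONDITIONAL on both conjunctions.
[cite: Kobayashi2003, Thm. 1.2 (p. 2) and Thm. 4.1 (p. 8)] [cite: BDKim2013, Cor. 3.15 (p. 199)]
[cite: CastellaWan2023, Thm. 5.3] [cite: Castella2018, Thm. 3.2] [cite: Miller2011LMS, §1 and Def. 1.1] -/
theorem bsdp_of_publishedInputsX6_of_publishedAcInputsX6ErrOdd_of_hasOddErratumPrime (hPub : PublishedInputsX6)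
    (hAcO : PublishedAcInputsX6ErrOdd) (W : WeierstrassCurve ℚ) [W.IsElliptic] [W.IsGloballyMinimal] (p : ℕ) [Fact p.Prime]
    (h5 : 5 ≤ p) (hX : ClassX6 W p) (h0 : W.analyticRank = 0) (hO : HasOddErratumPrime W p) : BSDp W p :=
  bsdp_of_missingPPartAt W p hPub.2.2.2.2.2.2.2.2 (by omega)
    (missingPPartAt_of_upper_of_nonUnit W p
      (Summit.BirchSwinnertonDyer.BirchSwinnertonDyer.Theorems.upperHalfX6_proof hPub W p (by omega) hX h0)
      (Summit.BirchSwinnertonDyer.BirchSwinnertonDyer.Theorems.AnticyclotomicRankZero.eisensteinHalfFiveLeErrOdd_of_facts hAcO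
        W p (ClassX6.not_hasCM W hX) h5 hX h0 hO))

/-! ### §1 Per record -/

namespace Record

variable (r : Record) [Fact r.p.Prime] [r.curve.IsElliptic] [r.curve.IsGloballyMinimal]

/-- **ODD-ERRATUM road (no open crux, no parity rider).** For a certified record at `p ≥ 5` with the odd certificate (`errOddAt`:
a listed bad ODD prime `q` non-split with `p ∤ ord_q Δ`, so `HasOddErratumPrime`, kernel theorem `hasOddErratum_of_check`) whose
claim holds: `BSD(E,p)` over `PublishedInputsX6 ∧ PublishedAcInputsX6ErrOdd`. What each of the 103 odd-erratum census cells at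
`p ≥ 5` inherits. CONDITIONAL on the two conjunctions. [cite: Kobayashi2003, Thm. 1.2 (p. 2) and Thm. 4.1 (p. 8)]
[cite: BDKim2013, Cor. 3.15 (p. 199)] [cite: SilvermanAEC2009, VII.5 Prop. 5.1(b)] [cite: Miller2011LMS, §1 and Def. 1.1] -/
theorem bsdp_of_errOddAt (hPub : PublishedInputsX6) (hAcO : PublishedAcInputsX6ErrOdd) (hc : r.check = true) (h : r.Claim)
    (h5 : 5 ≤ r.p) (he : r.errOddAt = true) : BSDp r.curve r.p :=
  bsdp_of_publishedInputsX6_of_publishedAcInputsX6ErrOdd_of_hasOddErratumPrime hPub hAcO r.curve r.p h5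
    (r.classX6_of_check hc) h.1 (r.hasOddErratum_of_check hc he)

/-- **ODD-ERRATUM road, claim-free**: the same over the record's own level-one enclosure line (`r_an = 0` by
`Record.analyticRank_eq_zero_of_LOneBall`; targets `(encI, encDen, cInf)` of p560348). NO open crux; no claim.
[cite: Kobayashi2003, Thm. 1.2 (p. 2) and Thm. 4.1 (p. 8)] [cite: BDKim2013, Cor. 3.15 (p. 199)] [cite: BirchSwinnertonDyer1965]
[cite: MazurTateTeitelbaum1986Invent, §I.8] [cite: Miller2011LMS, §1 and Def. 1.1] -/
theorem bsdp_of_errOddAt_of_LOneBall (hPub : PublishedInputsX6) (hAcO : PublishedAcInputsX6ErrOdd) (hc : r.check = true)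
    (h5 : 5 ≤ r.p) (he : r.errOddAt = true) {N : ℕ} [NeZero N] (f : CuspForm (Gamma0 N) 2)
    (hball0 : ∃ mid rad : ℝ, rad ≤ 1 / 10 ^ (20 : ℕ) ∧ |mid - (((r.encI : ℕ) : ℤ) : ℝ)| ≤ 1 / 10 ^ (20 : ℕ) ∧
      |((r.encDen : ℕ) : ℝ) * (((r.cInf : ℕ) : ℝ) * ((r.curve.entireLFunction 1).re / plusPeriod f)) - mid| ≤ rad) :
    BSDp r.curve r.p :=
  bsdp_of_publishedInputsX6_of_publishedAcInputsX6ErrOdd_of_hasOddErratumPrime hPub hAcO r.curve r.p h5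
    (r.classX6_of_check hc) (r.analyticRank_eq_zero_of_LOneBall hc f hball0) (r.hasOddErratum_of_check hc he)

end Record

/-! ### §2 The census over `allRecords`: the 103 odd-erratum records at `p ≥ 5` -/

section Lists

variable {rs : List Record}

/-- **ODD-ERRATUM road, list form, instance-free.** [cite: Kobayashi2003, Thm. 1.2 (p. 2) and Thm. 4.1 (p. 8)]
[cite: BDKim2013, Cor. 3.15 (p. 199)] [cite: Miller2011LMS, §1 and Def. 1.1] -/
theorem bsdp_of_certified_of_claims_of_errOddAt (hPub : PublishedInputsX6) (hAcO : PublishedAcInputsX6ErrOdd)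
    (hC : certified rs = true) (hcl : Claims rs) (r : Record) (hr : r ∈ rs) (h5 : 5 ≤ r.p) (he : r.errOddAt = true) :
    haveI := r.fact_prime_of_check (check_of_mem_of_certified hC hr)
    haveI := (r.elliptic_and_minimal_of_check (check_of_mem_of_certified hC hr)).1
    haveI := (r.elliptic_and_minimal_of_check (check_of_mem_of_certified hC hr)).2
    BSDp r.curve r.p := by
  have hc := check_of_mem_of_certified hC hr
  haveI := r.fact_prime_of_check hc
  haveI := (r.elliptic_and_minimal_of_check hc).1
  haveI := (r.elliptic_and_minimal_of_check hc).2
  exact r.bsdp_of_errOddAt hPub hAcO hc (hcl r hr) h5 he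

end Lists

/-- **The 103 odd-erratum census cells at `p ≥ 5`: `BSD(E,p)` by name with NO open crux and NO parity rider** — over
`PublishedInputsX6 ∧ PublishedAcInputsX6ErrOdd` and the records' claims, for every record of `allRecords` with `5 ≤ p` and the
odd certificate (`errOdd_counts_five_le`: 103 of 113; 78 @ 5, 18 @ 7, 4 @ 11, 3 @ 13). Tier of the repaired pack: the referee's
(α5); cells are booked by the director, not here. [cite: Kobayashi2003, Thm. 1.2 (p. 2) and Thm. 4.1 (p. 8)]
[cite: BDKim2013, Cor. 3.15 (p. 199)] [cite: Miller2011LMS, §1 and Def. 1.1] -/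
theorem bsdp_of_mem_errOddAt (hPub : PublishedInputsX6) (hAcO : PublishedAcInputsX6ErrOdd) (hcl : Claims allRecords)
    (r : Record) (hr : r ∈ allRecords) (h5 : 5 ≤ r.p) (he : r.errOddAt = true) :
    haveI := r.fact_prime_of_check (check_of_mem_of_certified certified_allRecords hr)
    haveI := (r.elliptic_and_minimal_of_check (check_of_mem_of_certified certified_allRecords hr)).1
    haveI := (r.elliptic_and_minimal_of_check (check_of_mem_of_certified certified_allRecords hr)).2
    BSDp r.curve r.p :=
  bsdp_of_certified_of_claims_of_errOddAt hPub hAcO certified_allRecords hcl r hr h5 he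

/-- **The 103 odd-erratum census cells at `p ≥ 5`, claim-free**: the two conjunctions and the record's own enclosure line (kit j287799
row) give `BSD(E,p)`. [cite: Kobayashi2003, Thm. 1.2 (p. 2) and Thm. 4.1 (p. 8)] [cite: BDKim2013, Cor. 3.15 (p. 199)]
[cite: BirchSwinnertonDyer1965] [cite: Miller2011LMS, §1 and Def. 1.1] -/
theorem bsdp_of_mem_errOddAt_of_LOneBall (hPub : PublishedInputsX6) (hAcO : PublishedAcInputsX6ErrOdd) (r : Record)
    (hr : r ∈ allRecords) (h5 : 5 ≤ r.p) (he : r.errOddAt = true) {N : ℕ} [NeZero N] (f : CuspForm (Gamma0 N) 2)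
    (hball0 : ∃ mid rad : ℝ, rad ≤ 1 / 10 ^ (20 : ℕ) ∧ |mid - (((r.encI : ℕ) : ℤ) : ℝ)| ≤ 1 / 10 ^ (20 : ℕ) ∧
      |((r.encDen : ℕ) : ℝ) * (((r.cInf : ℕ) : ℝ) * ((r.curve.entireLFunction 1).re / plusPeriod f)) - mid| ≤ rad) :
    haveI := r.fact_prime_of_check (check_of_mem_of_certified certified_allRecords hr)
    haveI := (r.elliptic_and_minimal_of_check (check_of_mem_of_certified certified_allRecords hr)).1
    haveI := (r.elliptic_and_minimal_of_check (check_of_mem_of_certified certified_allRecords hr)).2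
    BSDp r.curve r.p := by
  have hc := check_of_mem_of_certified certified_allRecords hr
  haveI := r.fact_prime_of_check hc
  haveI := (r.elliptic_and_minimal_of_check hc).1
  haveI := (r.elliptic_and_minimal_of_check hc).2
  exact r.bsdp_of_errOddAt_of_LOneBall hPub hAcO hc h5 he f hball0

/-- **Census coverage restated in the two packs' terms**: every listed record at `p ≥ 5` carries the odd certificate (this file's
road over `PublishedAcInputsX6ErrOdd`) or the narrowed-pair certificate (the guarded pair road, children5 v2 `RestPairGuard`) —
except exactly `246697a1, 321518d1 @ 5` (p577965 `errOdd_or_inertPairCoprime_counts_five_le`). [folklore] -/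
theorem errOddAt_or_inertPairCoprimeAt_of_mem_five_le (r : Record) (hr : r ∈ allRecords) (h5 : 5 ≤ r.p)
    (hne : r.label ≠ "246697a1" ∧ r.label ≠ "321518d1") : r.errOddAt = true ∨ r.inertPairCoprimeAt = true := by
  have hall : (allRecords.all fun r => !decide (5 ≤ r.p) || r.errOddAt || r.inertPairCoprimeAt ||
      (decide (r.label = "246697a1") || decide (r.label = "321518d1"))) = true := by
    decide +kernel
  have hx := List.all_eq_true.mp hall r hr
  simp only [Bool.or_eq_true, Bool.not_eq_true', decide_eq_false_iff_not, decide_eq_true_eq] at hx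
  rcases hx with (((hlt | he) | hP) | hL)
  · exact absurd h5 hlt
  · exact Or.inl he
  · exact Or.inr hP
  · exact absurd hL (not_or.mpr hne)

/-! ### §3 `hWeq` adapters and the cells by name -/

section Adapters

variable {rs : List Record} {W : WeierstrassCurve ℚ} [W.IsElliptic] [W.IsGloballyMinimal]
  {a1 a2 a3 a4 a6 : ℤ} {p : ℕ} [Fact p.Prime]

/-- **`BSD(E,p)` at an odd-erratum cell in the `hWeq` shape** (any of the 103 at `p ≥ 5`; membership `by decide +kernel` in the part
`recordsNN` holding the label): over `PublishedInputsX6 ∧ PublishedAcInputsX6ErrOdd` and an explicit `r_an = 0`. NO open crux, NO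
parity rider. [cite: Kobayashi2003, Thm. 1.2 (p. 2) and Thm. 4.1 (p. 8)] [cite: BDKim2013, Cor. 3.15 (p. 199)]
[cite: SilvermanAEC2009, VII.5 Prop. 5.1(b)] [cite: Miller2011LMS, §1 and Def. 1.1] -/
theorem bsdp_of_exists_errOddAt (hrs : certified rs = true)
    (h : ∃ r ∈ rs, r.ainvs = [a1, a2, a3, a4, a6] ∧ r.p = p ∧ r.errOddAt = true)
    (hWeq : W = ⟨a1, a2, a3, a4, a6⟩) (hPub : PublishedInputsX6) (hAcO : PublishedAcInputsX6ErrOdd) (h5 : 5 ≤ p)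
    (h0 : W.analyticRank = 0) : BSDp W p := by
  obtain ⟨r, hr, hA, hp, he⟩ := h
  have hc := check_of_mem_of_certified hrs hr
  have hW : W = r.curve := by rw [hWeq]; exact r.curve_eq hA
  subst hW
  subst hp
  exact bsdp_of_publishedInputsX6_of_publishedAcInputsX6ErrOdd_of_hasOddErratumPrime hPub hAcO r.curve r.p h5
    (r.classX6_of_check hc) h0 (r.hasOddErratum_of_check hc he)

/-- **`BSD(E,p)` at an odd-erratum cell from the packs and the cell files' LEVEL-ONE ENCLOSURE LINE, verbatim** (`hball0 : ∃ mid rad,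
rad ≤ R ∧ |mid − I| ≤ Mr ∧ |den·(c·(Re L(E,1)/Ω⁺_f)) − mid| ≤ rad`, `I ≠ 0`, `R + Mr < 1`): `r_an = 0` by the tree's UNCONDITIONAL
`Supersingular.analyticRank_eq_zero_of_LOneBall`. NO open crux. [cite: Kobayashi2003, Thm. 1.2 (p. 2) and Thm. 4.1 (p. 8)]
[cite: BDKim2013, Cor. 3.15 (p. 199)] [cite: BirchSwinnertonDyer1965] [cite: MazurTateTeitelbaum1986Invent, §I.8]
[cite: Miller2011LMS, §1 and Def. 1.1] -/
theorem bsdp_of_exists_errOddAt_of_LOneBall (hrs : certified rs = true)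
    (h : ∃ r ∈ rs, r.ainvs = [a1, a2, a3, a4, a6] ∧ r.p = p ∧ r.errOddAt = true)
    (hWeq : W = ⟨a1, a2, a3, a4, a6⟩) (hPub : PublishedInputsX6) (hAcO : PublishedAcInputsX6ErrOdd) (h5 : 5 ≤ p)
    {N : ℕ} [NeZero N] (f : CuspForm (Gamma0 N) 2) (R Mr den c : ℝ) (I : ℤ) (hI : I ≠ 0) (hsmall : R + Mr < 1)
    (hball0 : ∃ mid rad : ℝ, rad ≤ R ∧ |mid - ((I : ℤ) : ℝ)| ≤ Mr ∧
      |den * (c * ((W.entireLFunction 1).re / plusPeriod f)) - mid| ≤ rad) :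
    BSDp W p :=
  bsdp_of_exists_errOddAt hrs h hWeq hPub hAcO h5 (analyticRank_eq_zero_of_LOneBall f R Mr den c I hI hsmall hball0)

end Adapters

section Cells

variable {W : WeierstrassCurve ℚ} [W.IsElliptic] [W.IsGloballyMinimal] [Fact (Nat.Prime 5)]

/-- **The route's T3 witness cell `22678e1 @ 5`** (odd erratum primes `17, 23, 29`): `BSD(E,5)` over `PublishedInputsX6 ∧
PublishedAcInputsX6ErrOdd` and `r_an = 0` — the repaired Err road at the witness cell (fourth road there: p546341 descent, p558087 Err,
p577647 pair). [cite: Cremona2006, Table 1 (Cremona label 22678e1)] [cite: Miller2011LMS, §1 and Def. 1.1] -/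
theorem bsdp_cell_22678e1_at5_of_publishedInputsX6_of_publishedAcInputsX6ErrOdd
    (hWeq : W = ⟨1, 0, 0, 3140254662, -139987982322460⟩) (hPub : PublishedInputsX6) (hAcO : PublishedAcInputsX6ErrOdd)
    (h0 : W.analyticRank = 0) : BSDp W 5 :=
  bsdp_of_exists_errOddAt certified_records14 (by decide +kernel) hWeq hPub hAcO (by norm_num) h0

/-- `45298c1 @ 5` (odd erratum primes `11, 29`; single usable prime — NOT reached by the guarded pair road): `BSD(E,5)` over the two
conjunctions and `r_an = 0`. [cite: Cremona2006, Table 1 (Cremona label 45298c1)] -/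
theorem bsdp_cell_45298c1_at5_of_publishedInputsX6_of_publishedAcInputsX6ErrOdd
    (hWeq : W = ⟨1, 0, 1, -89330895996, 10276620855530340⟩) (hPub : PublishedInputsX6) (hAcO : PublishedAcInputsX6ErrOdd)
    (h0 : W.analyticRank = 0) : BSDp W 5 :=
  bsdp_of_exists_errOddAt certified_records14 (by decide +kernel) hWeq hPub hAcO (by norm_num) h0

/-- `75966b1 @ 5` (odd erratum primes `3, 1151`; not reached by the guarded pair road). [cite: Cremona2006, Table 1 (75966b1)] -/
theorem bsdp_cell_75966b1_at5_of_publishedInputsX6_of_publishedAcInputsX6ErrOdd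
    (hWeq : W = ⟨1, 1, 0, -278923575, -1781319902571⟩) (hPub : PublishedInputsX6) (hAcO : PublishedAcInputsX6ErrOdd)
    (h0 : W.analyticRank = 0) : BSDp W 5 :=
  bsdp_of_exists_errOddAt certified_records14 (by decide +kernel) hWeq hPub hAcO (by norm_num) h0

/-- `78483c1 @ 5` (odd erratum prime `3`; not reached by the guarded pair road). [cite: Cremona2006, Table 1 (78483c1)] -/
theorem bsdp_cell_78483c1_at5_of_publishedInputsX6_of_publishedAcInputsX6ErrOdd
    (hWeq : W = ⟨1, 1, 0, -517945, -143690396⟩) (hPub : PublishedInputsX6) (hAcO : PublishedAcInputsX6ErrOdd)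
    (h0 : W.analyticRank = 0) : BSDp W 5 :=
  bsdp_of_exists_errOddAt certified_records14 (by decide +kernel) hWeq hPub hAcO (by norm_num) h0

/-- `120974c1 @ 5` (odd erratum prime `8641`; not reached by the guarded pair road). [cite: Cremona2006, Table 1 (120974c1)] -/
theorem bsdp_cell_120974c1_at5_of_publishedInputsX6_of_publishedAcInputsX6ErrOdd
    (hWeq : W = ⟨1, 0, 1, -295891, -36908121810⟩) (hPub : PublishedInputsX6) (hAcO : PublishedAcInputsX6ErrOdd)
    (h0 : W.analyticRank = 0) : BSDp W 5 :=
  bsdp_of_exists_errOddAt certified_records14 (by decide +kernel) hWeq hPub hAcO (by norm_num) h0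

/-- `157263e1 @ 5` (odd erratum primes `3, 19, 89`; not reached by the guarded pair road). [cite: Cremona2006, Table 1 (157263e1)] -/
theorem bsdp_cell_157263e1_at5_of_publishedInputsX6_of_publishedAcInputsX6ErrOdd
    (hWeq : W = ⟨1, 1, 0, -16469380, -94411158587⟩) (hPub : PublishedInputsX6) (hAcO : PublishedAcInputsX6ErrOdd)
    (h0 : W.analyticRank = 0) : BSDp W 5 :=
  bsdp_of_exists_errOddAt certified_records14 (by decide +kernel) hWeq hPub hAcO (by norm_num) h0

/-- `266113a1 @ 5` (odd erratum prime `53`; not reached by the guarded pair road). [cite: Cremona2006, Table 1 (266113a1)] -/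
theorem bsdp_cell_266113a1_at5_of_publishedInputsX6_of_publishedAcInputsX6ErrOdd
    (hWeq : W = ⟨1, -1, 1, -30099600, 60800342170⟩) (hPub : PublishedInputsX6) (hAcO : PublishedAcInputsX6ErrOdd)
    (h0 : W.analyticRank = 0) : BSDp W 5 :=
  bsdp_of_exists_errOddAt certified_records14 (by decide +kernel) hWeq hPub hAcO (by norm_num) h0

/-- `280343c1 @ 5` (odd erratum primes `7, 29`; not reached by the guarded pair road). [cite: Cremona2006, Table 1 (280343c1)] -/
theorem bsdp_cell_280343c1_at5_of_publishedInputsX6_of_publishedAcInputsX6ErrOdd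
    (hWeq : W = ⟨0, -1, 1, -2633288, -1709156591⟩) (hPub : PublishedInputsX6) (hAcO : PublishedAcInputsX6ErrOdd)
    (h0 : W.analyticRank = 0) : BSDp W 5 :=
  bsdp_of_exists_errOddAt certified_records14 (by decide +kernel) hWeq hPub hAcO (by norm_num) h0

/-- `495403b1 @ 5` (odd erratum primes `43, 281`; not reached by the guarded pair road). [cite: Cremona2006, Table 1 (495403b1)] -/
theorem bsdp_cell_495403b1_at5_of_publishedInputsX6_of_publishedAcInputsX6ErrOdd
    (hWeq : W = ⟨0, -1, 1, -183032213, -953041054971⟩) (hPub : PublishedInputsX6) (hAcO : PublishedAcInputsX6ErrOdd)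
    (h0 : W.analyticRank = 0) : BSDp W 5 :=
  bsdp_of_exists_errOddAt certified_records15 (by decide +kernel) hWeq hPub hAcO (by norm_num) h0

end Cells

end Summit.BirchSwinnertonDyer.Rank1Residual.X6.PrintCert
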